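import Summits.CriticalPhenomena.PercolationContinuityZ3.Theorems.PercNearOneGluingNoHeavyLowerTailCondHarrisOffCluster
import Summits.CriticalPhenomena.PercolationContinuityZ3.Theorems.PercNearOneGluingNoHeavyLowerTailFourPointAtoms

/-!
# A new four-point exchange inequality, type B (all `n`): `μ(ab|c|y)·μ(a|bc|y) ≤ μ(a|b|c|y)·μ(abc|y)`

Support file for crux `stmt-CriticalPhenomena-4575` (master-family programme, row `Q44`, single-source packing;
MONO-A line), seat `prim-bnk-1` gen 33; memo `run/shared/lean/prim/prim-l12/FROM-prim-bnk-1-gen33-LAW-LEVEL-MONO-A.md` §3.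

For every finite weighted graph (`μ = prodBernoulli w` on a finite vertex type) and marked points `a b c y`, in the cell
numbering of `FourPointAtoms.pat4`
(`0 a|b|c|y, 1 a|b|cy, 2 a|by|c, 3 a|bc|y, 4 ay|b|c, 5 ac|b|y, 6 ab|c|y, 7 a|bcy, 8 ay|bc, 9 ac|by, 10 acy|b, 11 ab|cy, 12 aby|c, 13 abc|y, 14 abcy`):
**Type B** (`typeB_cell`): `cell 6 · cell 3 ≤ cell 0 · cell 13`, i.e. `μ(ab|c|y)·μ(a|bc|y) ≤ μ(a|b|c|y)·μ(abc|y)`; odds form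
`P(b↔c | a↔b, y isolated) ≥ P(b↔c | y isolated) ≥ P(b↔c | a↮{b,c}, y isolated)` — two conditional Harris inequalities given
`{y ↮ a,b,c}` (`CondHarris.condHarris_off_mono_mono`, `…_off_mono_anti`) and the dictionary events ↦ cells.  With type D
(`…FourPointExchangeD`) it gives E-MONO-A for the source edge `ay` (memo §4).  Numerically type B lies OUTSIDE the two-set BHK
exchange cone (memo §3).  Holds for all `a b c y` (coincidences only empty cells).  Also the shared bookkeeping (`ind` of
connection events is monotone and lives off the cluster of a disconnected source).  No named facts, no sorries, no definitions.
-/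

noncomputable section

namespace Summit.CriticalPhenomena.PercolationContinuityZ3.Theorems

namespace FourPointExchange

open MeasureTheory Set Literature.Probability.Percolation Literature.Probability.Percolation.BHK2006
open Literature.Probability.LatticeModels (prodBernoulli)
open DecisionTree (ind ind_of_mem ind_of_not_mem ind_nonneg)
open CondHarris FourPointAtoms
open Summit.CriticalPhenomena.PercolationContinuityZ3.Cruxes.AdditiveGluing.TieLine.ConnAtoms
open scoped Classical

variable {V : Type*}

/-! ## Indicator bookkeeping -/

/-- `openConn` is an increasing event. [folklore] -/
theorem ind_openConn_monotone (x z : V) : Monotone (ind (openConn x z) : Set (Sym2 V) → ℝ) := by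
  intro ω ω' h
  by_cases hω : ω ∈ openConn x z
  · have hω' : ω' ∈ openConn x z := SimpleGraph.Reachable.mono (openGraph_le h) hω
    rw [ind_of_mem hω, ind_of_mem hω']
  · rw [ind_of_not_mem hω]; exact ind_nonneg _ _

/-- `(openConn x z)ᶜ ∩ (openConn x u)ᶜ` is a decreasing event. [folklore] -/
theorem ind_compl_inter_antitone (x z u : V) :
    Antitone (ind ((openConn x z)ᶜ ∩ (openConn x u)ᶜ) : Set (Sym2 V) → ℝ) := by
  intro ω ω' h
  by_cases hω' : ω' ∈ (openConn x z)ᶜ ∩ (openConn x u)ᶜ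
  · have hω : ω ∈ (openConn x z)ᶜ ∩ (openConn x u)ᶜ :=
      ⟨fun h1 => hω'.1 (SimpleGraph.Reachable.mono (openGraph_le h) h1),
       fun h2 => hω'.2 (SimpleGraph.Reachable.mono (openGraph_le h) h2)⟩
    rw [ind_of_mem hω, ind_of_mem hω']
  · rw [ind_of_not_mem hω']; exact ind_nonneg _ _

/-- On `{s ↮ X}` with `x ∈ X`, the event `{x ↔ z}` lives off the cluster of `s`. [this work] -/
theorem ind_openConn_off {s x z : V} {X : Set V} (hx : x ∈ X) (ω : Set (Sym2 V)) (hω : ω ∈ {ω : Set (Sym2 V) | ∀ t ∈ X, ¬ (openGraph ω).Reachable s t}) :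
    ind (openConn x z) ω = ind (openConn x z) (ω \ {e : Sym2 V | ∃ v ∈ e, v = s ∨ ∃ e' ∈ openEdgeCluster ω s, v ∈ e'}) := by
  have h := reachable_iff_reachable_sdiff_bar (s := s) (t := x) (u := z) (ω := ω) (hω x hx)
  by_cases hr : ω ∈ openConn x z
  · rw [ind_of_mem hr, ind_of_mem (show ω \ {e : Sym2 V | ∃ v ∈ e, v = s ∨ ∃ e' ∈ openEdgeCluster ω s, v ∈ e'} ∈ openConn x z from h.1 hr)]
  · rw [ind_of_not_mem hr, ind_of_not_mem (show ω \ {e : Sym2 V | ∃ v ∈ e, v = s ∨ ∃ e' ∈ openEdgeCluster ω s, v ∈ e'} ∉ openConn x z from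
      fun h' => hr (h.2 h'))]

/-- On `{s ↮ X}` with `x ∈ X`, the event `{x ↮ z} ∩ {x ↮ u}` lives off the cluster of `s`. [this work] -/
theorem ind_compl_inter_off {s x z u : V} {X : Set V} (hx : x ∈ X) (ω : Set (Sym2 V)) (hω : ω ∈ {ω : Set (Sym2 V) | ∀ t ∈ X, ¬ (openGraph ω).Reachable s t}) :
    ind ((openConn x z)ᶜ ∩ (openConn x u)ᶜ) ω =
      ind ((openConn x z)ᶜ ∩ (openConn x u)ᶜ) (ω \ {e : Sym2 V | ∃ v ∈ e, v = s ∨ ∃ e' ∈ openEdgeCluster ω s, v ∈ e'}) := by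
  have h1 := reachable_iff_reachable_sdiff_bar (s := s) (t := x) (u := z) (ω := ω) (hω x hx)
  have h2 := reachable_iff_reachable_sdiff_bar (s := s) (t := x) (u := u) (ω := ω) (hω x hx)
  by_cases hr : ω ∈ (openConn x z)ᶜ ∩ (openConn x u)ᶜ
  · rw [ind_of_mem hr, ind_of_mem]
    exact ⟨fun h' => hr.1 (h1.2 h'), fun h' => hr.2 (h2.2 h')⟩
  · rw [ind_of_not_mem hr, ind_of_not_mem]
    intro h'
    exact hr ⟨fun hh => h'.1 (h1.1 hh), fun hh => h'.2 (h2.1 hh)⟩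

/-- `{ω : Set (Sym2 V) | ∀ t ∈ X, ¬ (openGraph ω).Reachable s t} = ∅` when `s ∈ X`. [folklore] -/
theorem Dis_eq_empty {s : V} {X : Set V} (hs : s ∈ X) : {ω : Set (Sym2 V) | ∀ t ∈ X, ¬ (openGraph ω).Reachable s t} = (∅ : Set (Set (Sym2 V))) :=
  Set.eq_empty_of_forall_notMem fun _ hω => hω s hs (SimpleGraph.Reachable.refl s)

/-- `{s ↮ x,z,u}` as an intersection of complements. [folklore] -/
theorem Dis_three_eq (s x z u : V) :
    {ω : Set (Sym2 V) | ∀ t ∈ ({x, z, u} : Set V), ¬ (openGraph ω).Reachable s t} = (openConn s x)ᶜ ∩ (openConn s z)ᶜ ∩ (openConn s u)ᶜ := by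
  ext ω
  simp only [Set.mem_setOf_eq, Set.mem_insert_iff, Set.mem_singleton_iff, forall_eq_or_imp, forall_eq,
    Set.mem_inter_iff, Set.mem_compl_iff, openConn, and_assoc]

/-- `{s ↮ z,u}` as an intersection of complements. [folklore] -/
theorem Dis_two_eq (s z u : V) : {ω : Set (Sym2 V) | ∀ t ∈ ({z, u} : Set V), ¬ (openGraph ω).Reachable s t} = (openConn s z)ᶜ ∩ (openConn s u)ᶜ := by
  ext ω
  simp only [Set.mem_setOf_eq, Set.mem_insert_iff, Set.mem_singleton_iff, forall_eq_or_imp, forall_eq,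
    Set.mem_inter_iff, Set.mem_compl_iff, openConn]

/-- `{x ↔ z}` read off the cluster of `x`: `1{x ↔ z}(ω) = 1_{S}(C_x ω)` with `S = {W | z = x ∨ ∃ e ∈ W, z ∈ e}`. [folklore] -/
theorem ind_openConn_eq_clusterFn (x z : V) (ω : Set (Sym2 V)) :
    ind (openConn x z) ω = ind {W : Set (Sym2 V) | z = x ∨ ∃ e ∈ W, z ∈ e} (openEdgeCluster ω x) := by
  by_cases h : ω ∈ openConn x z
  · rw [ind_of_mem h, ind_of_mem (show openEdgeCluster ω x ∈ {W : Set (Sym2 V) | z = x ∨ ∃ e ∈ W, z ∈ e} from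
      (reachable_iff_exists_mem_openEdgeCluster ω x z).1 h)]
  · rw [ind_of_not_mem h, ind_of_not_mem (show openEdgeCluster ω x ∉ {W : Set (Sym2 V) | z = x ∨ ∃ e ∈ W, z ∈ e} from
      fun h' => h ((reachable_iff_exists_mem_openEdgeCluster ω x z).2 h'))]

/-- The indicator of a complement. [folklore] -/
theorem one_sub_ind_openConn (x z : V) (ω : Set (Sym2 V)) :
    1 - ind (openConn x z) ω = ind (openConn x z)ᶜ ω := by
  by_cases h : ω ∈ openConn x z
  · rw [ind_of_mem h, ind_of_not_mem (fun h' : ω ∈ (openConn x z)ᶜ => h' h)]; ring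
  · rw [ind_of_not_mem h, ind_of_mem (Set.mem_compl h)]; ring

/-- The cluster function `1_{S}`, `S = {W | z = x ∨ ∃ e ∈ W, z ∈ e}`, is monotone. [folklore] -/
theorem clusterFn_monotone (x z : V) :
    Monotone (ind {W : Set (Sym2 V) | z = x ∨ ∃ e ∈ W, z ∈ e}) := by
  intro W W' h
  by_cases hW : W ∈ {W : Set (Sym2 V) | z = x ∨ ∃ e ∈ W, z ∈ e}
  · have hW' : W' ∈ {W : Set (Sym2 V) | z = x ∨ ∃ e ∈ W, z ∈ e} :=
      hW.imp id fun ⟨e, he, hz⟩ => ⟨e, h he, hz⟩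
    rw [ind_of_mem hW, ind_of_mem hW']
  · rw [ind_of_not_mem hW]; exact ind_nonneg _ _

/-- `1 - 1_S` is antitone. [folklore] -/
theorem one_sub_clusterFn_antitone (x z : V) :
    Antitone (fun W : Set (Sym2 V) => 1 - ind {W : Set (Sym2 V) | z = x ∨ ∃ e ∈ W, z ∈ e} W) :=
  fun _ _ h => sub_le_sub_left (clusterFn_monotone x z h) 1

variable [Fintype V] (w : Sym2 V → unitInterval) (a b c y : V)

/-- Probability of an intersection with `D` as a weighted sum of indicators. [folklore] -/
theorem real_inter_Dis (E : Set (Set (Sym2 V))) (s : V) (X : Set V) :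
    (prodBernoulli w).real (E ∩ {ω : Set (Sym2 V) | ∀ t ∈ X, ¬ (openGraph ω).Reachable s t}) = ∑ ω, weight (fun e => ((w e : unitInterval) : ℝ)) ω * (ind E ω * ind ({ω : Set (Sym2 V) | ∀ t ∈ X, ¬ (openGraph ω).Reachable s t}) ω) := by
  rw [measureReal_eq_sum]
  exact Finset.sum_congr rfl fun ω _ => by rw [BHK2006.ind_inter]

/-- Same with two events. [folklore] -/
theorem real_inter_inter_Dis (E F : Set (Set (Sym2 V))) (s : V) (X : Set V) :
    (prodBernoulli w).real (E ∩ F ∩ {ω : Set (Sym2 V) | ∀ t ∈ X, ¬ (openGraph ω).Reachable s t}) = ∑ ω, weight (fun e => ((w e : unitInterval) : ℝ)) ω * (ind E ω * ind F ω * ind ({ω : Set (Sym2 V) | ∀ t ∈ X, ¬ (openGraph ω).Reachable s t}) ω) := by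
  rw [measureReal_eq_sum]
  exact Finset.sum_congr rfl fun ω _ => by rw [BHK2006.ind_inter, BHK2006.ind_inter]

/-! ## Type B: `μ(ab|c|y) μ(a|bc|y) ≤ μ(⊥) μ(abc|y)` -/

section dictB
/-! Dictionary for type B: the five events as sums of cells (`Y = {y ↮ a} ∩ {y ↮ b} ∩ {y ↮ c}`). -/

/-- `μ({a↔b} ∩ {y ↮ a,b,c}) = cell 6 + cell 13`. [this work] -/
theorem realB_A : (prodBernoulli w).real (openConn a b ∩ ((openConn y a)ᶜ ∩ (openConn y b)ᶜ ∩ (openConn y c)ᶜ)) =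
    cell w a b c y 6 + cell w a b c y 13 := by
  rw [measureReal_eq_cellSum w a b c y (show HasPattern (quad a b c y)
      (openConn a b ∩ ((openConn y a)ᶜ ∩ (openConn y b)ᶜ ∩ (openConn y c)ᶜ)) _ from
    ((oc a b c y 0 1 rfl rfl).inter (((oc a b c y 3 0 rfl rfl).compl.inter (oc a b c y 3 1 rfl rfl).compl).inter
      (oc a b c y 3 2 rfl rfl).compl)))]
  simp (config := {decide := true}) only [ite_true, ite_false]; ring

/-- `μ({a↔b} ∩ {b↔c} ∩ {y ↮ a,b,c}) = cell 13`. [this work] -/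
theorem realB_AB : (prodBernoulli w).real (openConn a b ∩ openConn b c ∩ ((openConn y a)ᶜ ∩ (openConn y b)ᶜ ∩ (openConn y c)ᶜ)) =
    cell w a b c y 13 := by
  rw [measureReal_eq_cellSum w a b c y (show HasPattern (quad a b c y)
      (openConn a b ∩ openConn b c ∩ ((openConn y a)ᶜ ∩ (openConn y b)ᶜ ∩ (openConn y c)ᶜ)) _ from
    (((oc a b c y 0 1 rfl rfl).inter (oc a b c y 1 2 rfl rfl)).inter
      (((oc a b c y 3 0 rfl rfl).compl.inter (oc a b c y 3 1 rfl rfl).compl).inter (oc a b c y 3 2 rfl rfl).compl)))]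
  simp (config := {decide := true}) only [ite_true, ite_false]; ring

/-- `μ({b↔c} ∩ {y ↮ a,b,c}) = cell 3 + cell 13`. [this work] -/
theorem realB_B : (prodBernoulli w).real (openConn b c ∩ ((openConn y a)ᶜ ∩ (openConn y b)ᶜ ∩ (openConn y c)ᶜ)) =
    cell w a b c y 3 + cell w a b c y 13 := by
  rw [measureReal_eq_cellSum w a b c y (show HasPattern (quad a b c y)
      (openConn b c ∩ ((openConn y a)ᶜ ∩ (openConn y b)ᶜ ∩ (openConn y c)ᶜ)) _ from
    ((oc a b c y 1 2 rfl rfl).inter (((oc a b c y 3 0 rfl rfl).compl.inter (oc a b c y 3 1 rfl rfl).compl).inter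
      (oc a b c y 3 2 rfl rfl).compl)))]
  simp (config := {decide := true}) only [ite_true, ite_false]; ring

/-- `μ({b↔c} ∩ {a ↮ b,c} ∩ {y ↮ a,b,c}) = cell 3`. [this work] -/
theorem realB_BD : (prodBernoulli w).real (openConn b c ∩ ((openConn a b)ᶜ ∩ (openConn a c)ᶜ) ∩
      ((openConn y a)ᶜ ∩ (openConn y b)ᶜ ∩ (openConn y c)ᶜ)) = cell w a b c y 3 := by
  rw [measureReal_eq_cellSum w a b c y (show HasPattern (quad a b c y)
      (openConn b c ∩ ((openConn a b)ᶜ ∩ (openConn a c)ᶜ) ∩ ((openConn y a)ᶜ ∩ (openConn y b)ᶜ ∩ (openConn y c)ᶜ)) _ from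
    (((oc a b c y 1 2 rfl rfl).inter ((oc a b c y 0 1 rfl rfl).compl.inter (oc a b c y 0 2 rfl rfl).compl)).inter
      (((oc a b c y 3 0 rfl rfl).compl.inter (oc a b c y 3 1 rfl rfl).compl).inter (oc a b c y 3 2 rfl rfl).compl)))]
  simp (config := {decide := true}) only [ite_true, ite_false]; ring

/-- `μ({a ↮ b,c} ∩ {y ↮ a,b,c}) = cell 0 + cell 3`. [this work] -/
theorem realB_D : (prodBernoulli w).real (((openConn a b)ᶜ ∩ (openConn a c)ᶜ) ∩
      ((openConn y a)ᶜ ∩ (openConn y b)ᶜ ∩ (openConn y c)ᶜ)) = cell w a b c y 0 + cell w a b c y 3 := by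
  rw [measureReal_eq_cellSum w a b c y (show HasPattern (quad a b c y)
      (((openConn a b)ᶜ ∩ (openConn a c)ᶜ) ∩ ((openConn y a)ᶜ ∩ (openConn y b)ᶜ ∩ (openConn y c)ᶜ)) _ from
    (((oc a b c y 0 1 rfl rfl).compl.inter (oc a b c y 0 2 rfl rfl).compl).inter
      (((oc a b c y 3 0 rfl rfl).compl.inter (oc a b c y 3 1 rfl rfl).compl).inter (oc a b c y 3 2 rfl rfl).compl)))]
  simp (config := {decide := true}) only [ite_true, ite_false]; ring

/-- `μ({y ↮ a,b,c}) = cell 0 + cell 3 + cell 5 + cell 6 + cell 13`. [this work] -/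
theorem realB_Y : (prodBernoulli w).real ((openConn y a)ᶜ ∩ (openConn y b)ᶜ ∩ (openConn y c)ᶜ) =
    cell w a b c y 0 + cell w a b c y 3 + cell w a b c y 5 + cell w a b c y 6 + cell w a b c y 13 := by
  rw [measureReal_eq_cellSum w a b c y (show HasPattern (quad a b c y)
      ((openConn y a)ᶜ ∩ (openConn y b)ᶜ ∩ (openConn y c)ᶜ) _ from
    (((oc a b c y 3 0 rfl rfl).compl.inter (oc a b c y 3 1 rfl rfl).compl).inter (oc a b c y 3 2 rfl rfl).compl))]
  simp (config := {decide := true}) only [ite_true, ite_false]; ring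

end dictB

/-- **Type B exchange inequality** (all `n`, all marked points): `μ(ab|c|y) · μ(a|bc|y) ≤ μ(a|b|c|y) · μ(abc|y)`.
[this work] -/
theorem typeB_cell : cell w a b c y 6 * cell w a b c y 3 ≤ cell w a b c y 0 * cell w a b c y 13 := by
  have h0 := cell_nonneg w a b c y 0
  have h3 := cell_nonneg w a b c y 3
  have h5 := cell_nonneg w a b c y 5
  have h6 := cell_nonneg w a b c y 6
  have h13 := cell_nonneg w a b c y 13
  set X : Set V := {a, b, c} with hX
  have hYset : {ω : Set (Sym2 V) | ∀ t ∈ X, ¬ (openGraph ω).Reachable y t} = (openConn y a)ᶜ ∩ (openConn y b)ᶜ ∩ (openConn y c)ᶜ := Dis_three_eq y a b c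
  by_cases hy : y ∈ X
  · -- coincidence: `{y ↮ a,b,c} = ∅`, so `cell 3 = 0`
    have hBD := realB_BD w a b c y
    rw [← hYset, Dis_eq_empty hy, Set.inter_empty, measureReal_empty] at hBD
    rw [← hBD, mul_zero]
    exact mul_nonneg h0 h13
  -- the two conditional Harris inequalities given `{y ↮ a,b,c}`
  have ha : a ∈ X := by simp [hX]
  have hb : b ∈ X := by simp [hX]
  have i1 := condHarris_off_mono_mono w y X hy (ind_openConn_monotone a b) (ind_openConn_monotone b c)
    (fun _ => ind_nonneg _ _) (fun _ => ind_nonneg _ _) (ind_openConn_off ha) (ind_openConn_off hb)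
  have i2 := condHarris_off_mono_anti w y X hy (ind_openConn_monotone b c) (ind_compl_inter_antitone a b c)
    (fun _ => ind_nonneg _ _) (fun _ => BHK2006.ind_le_one _ _) (ind_openConn_off hb) (ind_compl_inter_off ha)
  rw [← real_inter_Dis, ← real_inter_Dis, ← measureReal_eq_sum, ← real_inter_inter_Dis, hYset,
    realB_A, realB_B, realB_Y, realB_AB] at i1
  rw [← real_inter_Dis, ← real_inter_Dis, ← measureReal_eq_sum, ← real_inter_inter_Dis, hYset,
    realB_B, realB_D, realB_Y, realB_BD] at i2
  -- algebra: i1: (c6+c13)(c3+c13) ≤ P c13 ; i2: P c3 ≤ (c3+c13)(c0+c3)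
  by_cases hc3 : cell w a b c y 3 = 0
  · rw [hc3, mul_zero]; exact mul_nonneg h0 h13
  have hc3' : 0 < cell w a b c y 3 := lt_of_le_of_ne h3 (Ne.symm hc3)
  nlinarith [mul_le_mul i1 i2 (by positivity) (by positivity), mul_pos hc3' hc3']

end FourPointExchange

end Summit.CriticalPhenomena.PercolationContinuityZ3.Theorems
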